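import Summits.CriticalPhenomena.PercolationContinuityZ3.Theorems.Transplant.FKDoubleFanWedge
import HarnessLib

/-!
# Double fans `K₂ ∨ P_{m+1}`: the INPUT side of the far cross-apex pair — letters commute with the input map, the rim step splits
# through the polarization `M(u)`, `M(u)` is a quadratic form with fifteen fixed bivector coefficients, `ℓ_D ∘ M = q·N^{(bc)}`, and the
# sharpness mechanism of `N^{(bc)}` along rim steps

Helper file (`--supports stmt-CriticalPhenomena-4575`), FK sub-lane `prim-bschramm-fk-3` (gen 29); builds on p205010 (kernel theorem, internal
audit signed; external expert review pending).  No named facts, no sorries; standard axioms; pure polynomial identities.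
Memo `bschramm/prim-bschramm-fk-3/FAR-CROSS-IV.md` §0(A),(B).

The input bivector of the cross-apex pair with prefix rest `u` is **`inputB u = u ∧ P_a u`** (`= wedgeH (AC⁰u) (AC¹u)`, **`wedgeH_cross_input_eq`**).
Because the letters are multiplication operators of the commutative algebra `V5`, they act on `inputB` through the SAME Bernstein splits as on a
pinned pair: **`inputB_conv_edgeAC`**, **`inputB_conv_edgeBC`**, **`inputB_conv_edgeAB`**.  The rim step does not commute with `P_a`; instead
**`inputB_rimStep`**: `inputB (E_r u) = r²·inputB u + r(1−r)·M(u) + (1−r)²·inputB (detach u)` with the RIM-STEP POLARIZATION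
**`inputM q u = detach u ∧ P_a u + u ∧ P_a (detach u)`**, and `inputB (detach u)` is an explicit non-negative combination of the three seed bivectors
`inputB δ₀`, `pieceDX`, `inputB (edgeAB 1)` (**`inputB_detach`**).  `M` is a quadratic form in the fibre masses of `u` (**`inputM_eq`**, explicit
coordinates), its `yv`-coordinate vanishes and, crucially, **`formD_inputM`**: `ℓ_D(M(u)) = q·N^{(bc)}(u)` — the detaching form of `…DoubleFanWedge` composed with
`M` is the master form of `…ThreeApexAlgebra`.  Finally the one-parameter family `P_c(Z) = Z_bc|Z| − c·κ_bc(Z)` (`P_{1−q} = N^{(bc)}`, **`kapFormP_oneSub`**) obeys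
**`kapFormP_rimStep`**: `P_c(E_rZ) = r·(r·P_c(Z) + (1−r)·S_c(Z))` with the rim-step EIGENFORM `S_c` (**`kapFormS_rimStep`**: `S_c(E_rZ) = r(r+(1−r)q)·S_c(Z)`) and
**`kapFormS_conv_edgeAC`** — the identities behind the sharpness of `N^{(bc)} ≥ 0` on the rim-step closure (memo §0(B)).
[cite: Grimmett2006, §3.9 eq. (3.94) (pp. 63–64)] [folklore]
-/

noncomputable section

namespace Summit.CriticalPhenomena.PercolationContinuityZ3.Theorems

namespace FK

namespace ThreeApex

/-! ### The input bivector and the letters -/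

/-- **The input bivector** of a prefix rest `u`: `u ∧ P_a u` in hat–Plücker coordinates. [folklore] -/
def inputB (u : V5) : Biv := wedgeH u (conv (edgeAC 1) u)

/-- The input of the cross-apex word, `wedgeH (AC⁰u) (AC¹u)`, is `inputB u` (`AC⁰ = δ₀` acts as the identity). [folklore] -/
theorem wedgeH_cross_input_eq (u : V5) : wedgeH (conv (edgeAC 0) u) (conv (edgeAC 1) u) = inputB u := by
  ext <;> simp only [inputB, wedgeH, conv, edgeAC, hx, hy, hz, V5.total] <;> ring

/-- The input bivector lies in the input face `{ux = uz = xz = yv = 0}`. [folklore] -/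
theorem inputB_face (u : V5) : (inputB u).ux = 0 ∧ (inputB u).uz = 0 ∧ (inputB u).xz = 0 ∧ (inputB u).yv = 0 := by
  refine ⟨?_, ?_, ?_, ?_⟩ <;> simp only [inputB, wedgeH, conv, edgeAC, hx, hy, hz, V5.total] <;> ring

/-- **An `a`-spoke in the prefix acts on the input by the Bernstein split `(1−x)²·I + x(1−x)·T_a + x²·W_a`** (the letter commutes with `P_a`). [folklore] -/
theorem inputB_conv_edgeAC (x : ℝ) (u : V5) :
    inputB (conv (edgeAC x) u) = Biv.lin3 ((1 - x) ^ 2) (inputB u) (x * (1 - x)) (opTa (inputB u)) (x ^ 2) (opWa (inputB u)) := by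
  ext <;> simp only [inputB, wedgeH, conv, edgeAC, Biv.lin3, Biv.add, Biv.smul, opTa, opWa, hx, hy, hz, V5.total] <;> ring

/-- **A `b`-spoke in the prefix acts on the input by `(1−y)²·I + y(1−y)·T_b + y²·W_b`.** [folklore] -/
theorem inputB_conv_edgeBC (y : ℝ) (u : V5) :
    inputB (conv (edgeBC y) u) = Biv.lin3 ((1 - y) ^ 2) (inputB u) (y * (1 - y)) (opTb (inputB u)) (y ^ 2) (opWb (inputB u)) := by
  ext <;> simp only [inputB, wedgeH, conv, edgeAC, edgeBC, Biv.lin3, Biv.add, Biv.smul, opTb, opWb, hx, hy, hz, V5.total] <;> ring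

/-- **The axis letter in the prefix acts on the input diagonally** (`opAB`). [folklore] -/
theorem inputB_conv_edgeAB (w : ℝ) (u : V5) : inputB (conv (edgeAB w) u) = opAB w (inputB u) := by
  ext <;> simp only [inputB, wedgeH, conv, edgeAC, edgeAB, opAB, hx, hy, hz, V5.total] <;> ring

/-! ### The rim step: the polarization `M` -/

/-- **The rim-step polarization of the input**: `M(u) = detach u ∧ P_a u + u ∧ P_a (detach u)`. [folklore] -/
def inputM (q : ℝ) (u : V5) : Biv :=
  Biv.add (wedgeH (detach q u) (conv (edgeAC 1) u)) (wedgeH u (conv (edgeAC 1) (detach q u)))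

/-- **The rim step on the input splits as `r²·inputB u + r(1−r)·M(u) + (1−r)²·inputB (detach u)`.** [folklore] -/
theorem inputB_rimStep (q r : ℝ) (u : V5) :
    inputB (rimStep q r u) = Biv.lin3 (r ^ 2) (inputB u) (r * (1 - r)) (inputM q u) ((1 - r) ^ 2) (inputB (detach q u)) := by
  ext <;> simp only [inputB, inputM, wedgeH, conv, edgeAC, rimStep, detach, Biv.lin3, Biv.add, Biv.smul, hx, hy, hz, V5.total] <;> ring

/-- The mixed seed bivector `e_d ∧ P_a e_x + e_x ∧ P_a e_d` (`e_d = δ₀`, `e_x = edgeAB 1`): coordinates `uv = 1, xy = 1, xv = 2, zv = 1`. [folklore] -/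
def pieceDX : Biv := ⟨0, 0, 0, 1, 1, 0, 2, 0, 0, 1⟩

/-- The two pure seeds: `inputB δ₀ = (0,1,0,1,1,0,1,−1,0,1)` and `inputB (edgeAB 1) = e_xv`. [folklore] -/
theorem inputB_seeds : inputB delta0 = ⟨0, 1, 0, 1, 1, 0, 1, -1, 0, 1⟩ ∧ inputB (edgeAB 1) = ⟨0, 0, 0, 0, 0, 0, 1, 0, 0, 0⟩ := by
  constructor <;> (ext <;> simp only [inputB, wedgeH, conv, edgeAC, edgeAB, delta0, hx, hy, hz, V5.total] <;> ring)

/-- **The detached input is a non-negative combination of the three seeds**: with `d' = qZ_0 + Z_ac + Z_bc`, `x' = qZ_ab + Z_1` (the two masses of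
`detach u`), `inputB (detach u) = d'²·inputB δ₀ + d'x'·pieceDX + x'²·inputB (edgeAB 1)`. [folklore] -/
theorem inputB_detach (q : ℝ) (u : V5) :
    inputB (detach q u) = Biv.lin3 ((q * u.z0 + u.zac + u.zbc) ^ 2) (inputB delta0) ((q * u.z0 + u.zac + u.zbc) * (q * u.zab + u.z1)) pieceDX
      ((q * u.zab + u.z1) ^ 2) (inputB (edgeAB 1)) := by
  rw [inputB_seeds.1, inputB_seeds.2]
  ext <;> simp only [inputB, pieceDX, wedgeH, conv, edgeAC, detach, Biv.lin3, Biv.add, Biv.smul, hx, hy, hz, V5.total] <;> ring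

/-- **`M(u)` in coordinates**: a quadratic form in the fibre masses (`ux = uz = xz = yv = 0`; in particular `M` also maps into the input face).
[folklore] -/
theorem inputM_eq (q : ℝ) (u : V5) :
    inputM q u =
      ⟨0,
       2 * q * u.z0 ^ 2 + (2 + q) * u.z0 * u.zac + 2 * u.z0 * u.zbc + u.zac ^ 2 + u.zac * u.zbc,
       0,
       2 * q * u.z0 ^ 2 + 2 * q * u.z0 * u.zab + (2 + q) * u.z0 * u.zac + (2 + q) * u.z0 * u.zbc + (1 + q) * u.z0 * u.z1 + u.zab * u.zac
         + u.zab * u.zbc + u.zac ^ 2 + 2 * u.zac * u.zbc + u.zac * u.z1 + u.zbc ^ 2 + u.zbc * u.z1,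
       2 * q * u.z0 ^ 2 + 2 * q * u.z0 * u.zab + (2 + q) * u.z0 * u.zac + 2 * u.z0 * u.zbc + u.z0 * u.z1 + (1 + q) * u.zab * u.zac
         + u.zab * u.zbc + u.zac ^ 2 + u.zac * u.zbc + u.zac * u.z1,
       0,
       2 * q * u.z0 ^ 2 + 4 * q * u.z0 * u.zab + (2 + q) * u.z0 * u.zac + (2 + q) * u.z0 * u.zbc + (2 + q) * u.z0 * u.z1 + 2 * q * u.zab ^ 2
         + (2 + q) * u.zab * u.zac + (2 + q) * u.zab * u.zbc + (2 + q) * u.zab * u.z1 + u.zac ^ 2 + 2 * u.zac * u.zbc + 2 * u.zac * u.z1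
         + u.zbc ^ 2 + 2 * u.zbc * u.z1 + u.z1 ^ 2,
       -(2 * q * u.z0 ^ 2 + (2 + q) * u.z0 * u.zac + (2 + q) * u.z0 * u.zbc + u.zac ^ 2 + 2 * u.zac * u.zbc + u.zbc ^ 2),
       0,
       2 * q * u.z0 ^ 2 + 2 * q * u.z0 * u.zab + (2 + q) * u.z0 * u.zac + (2 + 2 * q) * u.z0 * u.zbc + (1 + q) * u.z0 * u.z1 + u.zab * u.zac
         + (1 + q) * u.zab * u.zbc + u.zac ^ 2 + 3 * u.zac * u.zbc + u.zac * u.z1 + 2 * u.zbc ^ 2 + 2 * u.zbc * u.z1⟩ := by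
  ext <;> simp only [inputM, wedgeH, conv, edgeAC, detach, Biv.add, hx, hy, hz, V5.total] <;> ring

/-- **`ℓ_D ∘ M = q · N^{(bc)}`**: the detaching form of the rim-step polarization of the input is `q` times the master form with middle block `bc`
(so `M(u)` lies on the facet `ℓ_D = 0` exactly when `N^{(bc)}(u) = 0`). [folklore] -/
theorem formD_inputM (q : ℝ) (u : V5) : formD q (inputM q u) = q * masterN q (swapAB u) := by
  simp only [formD, inputM, wedgeH, conv, edgeAC, detach, Biv.add, hx, hy, hz, V5.total, masterN, swapAB]; ring

/-- The `yv`- and `zv`-signs of `M(u)`: `M(u)_yv = 0` and `M(u)_zv` is a polynomial with non-negative coefficients in the masses (`0 ≤ q`). [folklore] -/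
theorem inputM_signs {q : ℝ} (hq : 0 ≤ q) {u : V5} (hu : u.Nonneg) : (inputM q u).yv = 0 ∧ 0 ≤ (inputM q u).zv := by
  obtain ⟨h0, h1, h2, h3, h4⟩ := hu
  rw [inputM_eq]
  exact ⟨rfl, by positivity⟩

/-! ### The sharpness mechanism of `N^{(bc)}` along rim steps -/

/-- The one-parameter family `P_c(Z) = Z_bc·|Z| − c·κ_bc(Z)` (`κ_bc = kap ∘ swapAB`). [folklore] -/
def kapFormP (c : ℝ) (Z : V5) : ℝ := Z.zbc * Z.total - c * kap (swapAB Z)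

/-- Its rim-step companion `S_c(Z) = (1−c)·Z_bc|Z| + (c−(1−q))·Z_bc·(Z_0+Z_ab) − qc·κ_bc(Z)`. [folklore] -/
def kapFormS (q c : ℝ) (Z : V5) : ℝ := (1 - c) * Z.zbc * Z.total + (c - (1 - q)) * Z.zbc * (Z.z0 + Z.zab) - q * c * kap (swapAB Z)

/-- `P_{1−q} = N^{(bc)}`: the master form is the member `c = 1 − q` of the family. [folklore] -/
theorem kapFormP_oneSub (q : ℝ) (Z : V5) : kapFormP (1 - q) Z = masterN q (swapAB Z) := by
  simp only [kapFormP, kap, masterN, swapAB, V5.total]; ring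

/-- `S_{1−q} = q·N^{(bc)}`. [folklore] -/
theorem kapFormS_oneSub (q : ℝ) (Z : V5) : kapFormS q (1 - q) Z = q * masterN q (swapAB Z) := by
  simp only [kapFormS, kap, masterN, swapAB, V5.total]; ring

/-- **Rim step on `P_c`**: `P_c(E_rZ) = r·(r·P_c(Z) + (1−r)·S_c(Z))` — so `P_c ≥ 0` survives rim steps iff `S_c ≥ 0` does. [folklore] -/
theorem kapFormP_rimStep (q c r : ℝ) (Z : V5) :
    kapFormP c (rimStep q r Z) = r * (r * kapFormP c Z + (1 - r) * kapFormS q c Z) := by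
  simp only [kapFormP, kapFormS, kap, swapAB, rimStep, V5.total]; ring

/-- **`S_c` is a rim-step eigenform**: `S_c(E_rZ) = r(r + (1−r)q)·S_c(Z)` (the scaling of `N^{(bc)}`, `masterNbc_rimStep`, is the case `c = 1−q`).
[folklore] -/
theorem kapFormS_rimStep (q c r : ℝ) (Z : V5) : kapFormS q c (rimStep q r Z) = r * (r + (1 - r) * q) * kapFormS q c Z := by
  simp only [kapFormS, kap, swapAB, rimStep, V5.total]; ring

/-- **`S_c` after an `a`-spoke**: `S_c(AC_t Z) = (1−t)·[(1−c)Z_bc|Z| − qc·κ_bc(Z)] + (1−t)²·(c−(1−q))·Z_bc(Z_0+Z_ab)`; for `t → 1` the bracket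
`= (1−c)·P_{qc/(1−c)}(Z)` dominates — the iteration `c ↦ qc/(1−c)` that leaves only `c ≤ 1−q` (memo §0(B)). [folklore] -/
theorem kapFormS_conv_edgeAC (q c t : ℝ) (Z : V5) :
    kapFormS q c (conv (edgeAC t) Z) =
      (1 - t) * ((1 - c) * (Z.zbc * Z.total) - q * c * kap (swapAB Z)) + (1 - t) ^ 2 * ((c - (1 - q)) * (Z.zbc * (Z.z0 + Z.zab))) := by
  simp only [kapFormS, kap, swapAB, conv, edgeAC, V5.total]; ring

/-- The bracket of `kapFormS_conv_edgeAC` is `(1−c)·P_{qc/(1−c)}` (`c ≠ 1`). [folklore] -/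
theorem kapFormP_next {c : ℝ} (hc : c ≠ 1) (q : ℝ) (Z : V5) :
    (1 - c) * (Z.zbc * Z.total) - q * c * kap (swapAB Z) = (1 - c) * kapFormP (q * c / (1 - c)) Z := by
  have h : (1 - c) ≠ 0 := sub_ne_zero.2 (Ne.symm hc)
  simp only [kapFormP]
  field_simp

end ThreeApex

end FK

end Summit.CriticalPhenomena.PercolationContinuityZ3.Theorems
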